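import Summits.ValiantsHypothesis.ValiantsHypothesis.Theses.TwistedDetRank
import Summits.ValiantsHypothesis.ValiantsHypothesis.Theorems.TwistedDetRankFermionicNormalFormDefs
import Summits.ValiantsHypothesis.ValiantsHypothesis.Theorems.TwistedDetRankFermionicNormalFormConeGlue
import Summits.ValiantsHypothesis.ValiantsHypothesis.Theorems.TwistedDetRankFermionicNormalFormSummitHard
import Summits.ValiantsHypothesis.ValiantsHypothesis.Theorems.TwistedDetRankFermionicNormalFormLocalGenerators
import Summits.ValiantsHypothesis.ValiantsHypothesis.Theses.ProofCarryingSymmetry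
import Summits.ValiantsHypothesis.ValiantsHypothesis.Theorems.ProofCarryingSymmetrySquareSymmetricPermLB
import Summits.ValiantsHypothesis.ValiantsHypothesis.Theorems.ProofCarryingSymmetryAssembly
import Literature.Computability.AlgebraicComplexity.SymmetricArithCircuit

/-!
# Line `symmetric` — crux `FermionicNormalForm` (item `stmt-ValiantsHypothesis-6283`), strategist line

Route `route-ValiantsHypothesis-TwistedDetRank`, crux
`Summit.ValiantsHypothesis.ValiantsHypothesis.Theses.TwistedDetRank.FermionicNormalForm` (X2):
every p-computable CLASS-FUNCTION generalised matrix function `f_n = Σ_σ χ_n(σ) Π_i X_{σ(i),i}`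
is, for `n ≥ 1`, a sum of quasi-polynomially many Hadamard-twisted determinants `det(X ∘ E_t)`.

WHY A SECOND LINE.  The live line `registered` (`Lines/birth.lean`, lead
prover-line-stmt-ValiantsHypothesis-6283-0) is CLASSIFICATION (A: p-computable class-function GMF
⇒ quasi-local coefficients, `CheapClassFunctionsAreQuasiLocal`) ∘ CONSTRUCTION (B: local
generators have `≤ (n+1)^(w+1)` twisted determinants, `LocalGeneratorsSmallTdr`, proved piecewise).
Its stuck goal is A: a lower-bound statement for general circuits none of whose non-trivial
instances is provable by a known technique (its `χ ≡ 1` instance is the summit: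
`valiantsHypothesis_of_cheapClassFunctionsAreQuasiLocal`, landed).  This line FACTORS A THROUGH
SQUARE-SYMMETRIC CIRCUITS (Dawar–Wilsenach: circuits on the variable matrix `x_ij` invariant, up
to circuit automorphism, under `x_ij ↦ x_{π i, π j}` — exactly the symmetry of a class-function
GMF, `rename_smul_gmf` below):

* R  = `stub_restorationClassGMF` — SYMMETRY RESTORATION on the class-function GMF slice: a
  p-computable class-function GMF family has `S_n`-symmetric labelled circuits of
  quasi-polynomial size.  This is the restriction to class-function GMFs of the crux
  `ProofCarryingSymmetry.RestorationQP` (item stmt-ValiantsHypothesis-10343, staffed by route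
  ProofCarryingSymmetry; kernel-checked below: `restorationClassGMF_of_restorationQP`), so the
  summit-hard core of X2 is MERGED with an existing bet instead of duplicated (and inherits that
  route's layer-2 plan: PI-provability of invariance ∧ stability of provable symmetry).
  CALIBRATION (honest, kernel-checked below): R alone implies the summit
  (`valiantsHypothesis_of_restorationClassGMF`, via Dawar–Wilsenach Thm 7.1, which is PROVED in
  the tree: `squareSymmetricPermLB_proof` ← `DawarWilsenach2025_thm71_holds`).  Nothing can avoid
  this: the crux itself implies the summit (`valiantsHypothesis_of_fermionicNormalForm`, landed).
* SymA = `stub_symmetricCircuitsQuasiLocal` — SYMMETRIC CIRCUITS SEE ONLY QUASI-LOCAL CLASS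
  FUNCTIONS: if the GMF family of `χ` has `S_n`-symmetric circuits of size `2^((log₂ n + c)^c)`
  then `χ` is quasi-local.  VH-free and NEW; its `χ ≡ 1` instance is exactly Dawar–Wilsenach's
  theorem (`per` has no `2^{o(n)}` square-symmetric circuits; `χ ≡ 1` is not quasi-local,
  `one_not_isQuasiLocal`) — see `no_qp_symmetric_circuits_for_per_of_symA` below — and in general
  it reduces, through the in-tree Thm 6.4 (orbit size vs counting width,
  `DawarWilsenach2025_orbitSize_countingWidth_holds`) and Thm 5.1 (threshold translation), to a
  finite-model-theory statement: the graph parameter `A ↦ f_χ(A)` of a non-quasi-local class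
  function has counting width `ω(polylog n)` (CFI constructions / bijection games,
  `Literature/ModelTheory/FiniteModelTheory`).  That toolbox does not exist for A.
* B (no stub — LANDED): the construction half of line `registered`, `LocalGeneratorsSmallTdr`, is a
  theorem of the tree (`…Theorems.TwistedDetRankFermionicNormalForm.stub_localGeneratorsSmallTdr`,
  p149046, Theorems/TwistedDetRankFermionicNormalFormLocalGenerators.lean) and is used as such.

Composition (kernel-checked, no `sorry`): `FermionicNormalForm_of : R → SymA → FermionicNormalForm`
(quasi-local expansion from SymA ∘ R, one cone sum per generator from the landed B in coefficient form
`repr_of_gmf_eq`, linear combination `cone_lincomb`, back to polynomials `gmf_eq_of_repr`, count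
`qp_mul_absorb`).  Skeleton v2 (v1 carried B as a third, shared stub before it landed).

Disproof used: none exists for this crux (`ledger crux ls`: no `Disproof.lean`, nothing under
`Theorems/…/FermionicNormalForm/Negative/`).  The `1 ≤ n` guard of the crux is honoured (B and
`IsQuasiLocal` carry it).  Negatives index (`ledger negatives --problem ValiantsHypothesis`):
nothing on class-function GMFs, twisted determinants or symmetric circuits.

References: A. Dawar, G. Wilsenach, *Symmetric Arithmetic Circuits*, ICALP 2020 / ToC 21 (2025)
(arXiv:2002.06451), Thms 4.1, 5.1, 6.4, 7.1; A. Dawar, G. Wilsenach, ITCS 2022 (arXiv:2107.10986);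
R. Curticapean, STOC 2021 (arXiv:2102.04340); P. Bürgisser 2000, Ch. 2 and Ch. 7;
M. Marcus, H. Minc, Illinois J. Math. 5 (1961).
-/

set_option linter.dupNamespace false

noncomputable section

namespace Summit.ValiantsHypothesis.ValiantsHypothesis.Cruxes.FermionicNormalForm.Symmetric

open Summit.ValiantsHypothesis.ValiantsHypothesis.Theses.TwistedDetRank
open Literature.Computability.AlgebraicComplexity
open Summit.ValiantsHypothesis.ValiantsHypothesis.Theorems.TwistedDetRankFermionicNormalForm
open scoped BigOperators

/-! ## §1 The stubs -/

/-- Stub R — SYMMETRY RESTORATION ON THE CLASS-FUNCTION GMF SLICE (the restriction of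
`ProofCarryingSymmetry.RestorationQP`, stmt-ValiantsHypothesis-10343, to class-function GMFs; see
`restorationClassGMF_of_restorationQP`): a p-computable class-function GMF family has, for some `c`
and every `n`, an `S_n`-symmetric labelled arithmetic circuit over `ℂ` (diagonal action on
`Fin n × Fin n`, trivial on the single output) of size `≤ 2^((log₂ n + c)^c)` computing `f_n`.
At least summit-hard (`valiantsHypothesis_of_restorationClassGMF`).
[conjecture-grade: DawarWilsenach2025, DawarPagoSeppelt2025, DwivediPagoSeppelt2026] -/
theorem stub_restorationClassGMF :
    ∀ χ : (n : ℕ) → Equiv.Perm (Fin n) → ℂ,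
      (∀ (n : ℕ) (σ τ : Equiv.Perm (Fin n)), χ n (τ * σ * τ⁻¹) = χ n σ) →
      IsPComputable (fun n => ∑ σ : Equiv.Perm (Fin n), MvPolynomial.C (χ n σ) *
        ∏ i : Fin n, (MvPolynomial.X (σ i, i) : MvPolynomial (Fin n × Fin n) ℂ)) →
      ∃ c : ℕ, ∀ n : ℕ, ∃ (G : Type) (_ : Fintype G)
        (C : LabelledArithCircuit ℂ (Fin n × Fin n) Unit G),
        C.IsSymmetric (Equiv.Perm (Fin n)) ∧
        C.eval (C.output ()) = (∑ σ : Equiv.Perm (Fin n), MvPolynomial.C (χ n σ) *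
          ∏ i : Fin n, (MvPolynomial.X (σ i, i) : MvPolynomial (Fin n × Fin n) ℂ)) ∧
        Fintype.card G ≤ 2 ^ ((Nat.log 2 n + c) ^ c) := by
  sorry

/-- Stub SymA — SYMMETRIC CIRCUITS SEE ONLY QUASI-LOCAL CLASS FUNCTIONS (VH-free; new): if the GMF
family of `χ` is computed by `S_n`-symmetric labelled circuits of size `≤ 2^((log₂ n + c)^c)`, then
`χ` is quasi-local (`IsQuasiLocal`: for `n ≥ 1` a combination of `≤ 2^((log₂ n + c')^c')` local
generators of weight `≤ (log₂ n + c')^c'`).  Its `χ ≡ 1` instance is Dawar–Wilsenach Thm 7.1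
(`no_qp_symmetric_circuits_for_per_of_symA`); in general it is a counting-width statement via the
in-tree Thms 5.1 / 6.4. [conjecture-grade: DawarWilsenach2025 Thms 5.1, 6.4, 7.1; arXiv:2107.10986] -/
theorem stub_symmetricCircuitsQuasiLocal :
    ∀ χ : (n : ℕ) → Equiv.Perm (Fin n) → ℂ,
      (∃ c : ℕ, ∀ n : ℕ, ∃ (G : Type) (_ : Fintype G)
        (C : LabelledArithCircuit ℂ (Fin n × Fin n) Unit G),
        C.IsSymmetric (Equiv.Perm (Fin n)) ∧
        C.eval (C.output ()) = (∑ σ : Equiv.Perm (Fin n), MvPolynomial.C (χ n σ) *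
          ∏ i : Fin n, (MvPolynomial.X (σ i, i) : MvPolynomial (Fin n × Fin n) ℂ)) ∧
        Fintype.card G ≤ 2 ^ ((Nat.log 2 n + c) ^ c)) →
      IsQuasiLocal χ := by
  sorry

/-! ## Name-keyed aliases of the stub statements (hypotheses of the composition; device of
`Lines/birth.lean`: the skeleton audit admits hypotheses that are declared stubs BY NAME) -/
namespace Registered

/-- Statement of `stub_restorationClassGMF` (R). -/
abbrev stub_restorationClassGMF : Prop :=
  ∀ χ : (n : ℕ) → Equiv.Perm (Fin n) → ℂ,
    (∀ (n : ℕ) (σ τ : Equiv.Perm (Fin n)), χ n (τ * σ * τ⁻¹) = χ n σ) →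
    IsPComputable (fun n => ∑ σ : Equiv.Perm (Fin n), MvPolynomial.C (χ n σ) *
      ∏ i : Fin n, (MvPolynomial.X (σ i, i) : MvPolynomial (Fin n × Fin n) ℂ)) →
    ∃ c : ℕ, ∀ n : ℕ, ∃ (G : Type) (_ : Fintype G)
      (C : LabelledArithCircuit ℂ (Fin n × Fin n) Unit G),
      C.IsSymmetric (Equiv.Perm (Fin n)) ∧
      C.eval (C.output ()) = (∑ σ : Equiv.Perm (Fin n), MvPolynomial.C (χ n σ) *
        ∏ i : Fin n, (MvPolynomial.X (σ i, i) : MvPolynomial (Fin n × Fin n) ℂ)) ∧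
      Fintype.card G ≤ 2 ^ ((Nat.log 2 n + c) ^ c)

/-- Statement of `stub_symmetricCircuitsQuasiLocal` (SymA). -/
abbrev stub_symmetricCircuitsQuasiLocal : Prop :=
  ∀ χ : (n : ℕ) → Equiv.Perm (Fin n) → ℂ,
    (∃ c : ℕ, ∀ n : ℕ, ∃ (G : Type) (_ : Fintype G)
      (C : LabelledArithCircuit ℂ (Fin n × Fin n) Unit G),
      C.IsSymmetric (Equiv.Perm (Fin n)) ∧
      C.eval (C.output ()) = (∑ σ : Equiv.Perm (Fin n), MvPolynomial.C (χ n σ) *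
        ∏ i : Fin n, (MvPolynomial.X (σ i, i) : MvPolynomial (Fin n × Fin n) ℂ)) ∧
      Fintype.card G ≤ 2 ^ ((Nat.log 2 n + c) ^ c)) →
    IsQuasiLocal χ

end Registered

/-! ## §2 Glue (sorry-free) -/

/-- Count bookkeeping: with `M = (log₂ n + c₁)^c₁`, `2^M · (n+1)^(M+1) ≤ 2^((log₂ n + c)^c)` for
`c = c₁ + 3` and every `n` (verbatim from line `registered`). [folklore] -/
theorem qp_mul_absorb (c₁ : ℕ) : ∃ c : ℕ, ∀ n : ℕ,
    2 ^ ((Nat.log 2 n + c₁) ^ c₁) * (n + 1) ^ ((Nat.log 2 n + c₁) ^ c₁ + 1) ≤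
      2 ^ ((Nat.log 2 n + c) ^ c) := by
  refine ⟨c₁ + 3, fun n => ?_⟩
  have hn : n < 2 ^ (Nat.log 2 n + 1) := Nat.lt_pow_succ_log_self Nat.one_lt_two n
  generalize Nat.log 2 n = L at hn ⊢
  set M : ℕ := (L + c₁) ^ c₁ with hM
  set B : ℕ := L + (c₁ + 3) with hB
  have hB1 : 1 ≤ B := by omega
  have hB2 : 2 ≤ B := by omega
  have hMB : M ≤ B ^ c₁ := by
    rw [hM]; exact Nat.pow_le_pow_left (by omega) _
  have hpow1 : 1 ≤ B ^ c₁ := Nat.one_le_pow _ _ (by omega)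
  have hexp : M + (L + 1) * (M + 1) ≤ B ^ (c₁ + 3) :=
    calc M + (L + 1) * (M + 1) ≤ (L + 2) * (M + 1) := by nlinarith
      _ ≤ B * (B ^ c₁ + 1) := Nat.mul_le_mul (by omega) (by omega)
      _ ≤ B * (2 * B ^ c₁) := Nat.mul_le_mul_left _ (by omega)
      _ ≤ B * (B * B ^ c₁) := Nat.mul_le_mul_left _ (Nat.mul_le_mul_right _ hB2)
      _ = B ^ (c₁ + 2) := by ring
      _ ≤ B ^ (c₁ + 3) := Nat.pow_le_pow_right hB1 (by omega)
  have hbase : (n + 1) ^ (M + 1) ≤ 2 ^ ((L + 1) * (M + 1)) :=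
    calc (n + 1) ^ (M + 1) ≤ (2 ^ (L + 1)) ^ (M + 1) := Nat.pow_le_pow_left (by omega) _
      _ = 2 ^ ((L + 1) * (M + 1)) := (pow_mul 2 _ _).symm
  calc 2 ^ M * (n + 1) ^ (M + 1) ≤ 2 ^ M * 2 ^ ((L + 1) * (M + 1)) := Nat.mul_le_mul_left _ hbase
    _ = 2 ^ (M + (L + 1) * (M + 1)) := (pow_add 2 _ _).symm
    _ ≤ 2 ^ (B ^ (c₁ + 3)) := Nat.pow_le_pow_right (by norm_num) hexp

/-- **Quasi-local coefficients + B ⇒ few twisted determinants** (the route header's planned node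
`QuasiLocalHaveSmallTdr`, at the level the crux consumes): take the quasi-local expansion
`χ_n = Σ_{t<r} a_t • g_t`, one cone sum of length `(n+1)^(M+1)` per generator from B in coefficient
form (`repr_of_gmf_eq`), the linear combination as one cone sum of length `r·(n+1)^(M+1)`
(`cone_lincomb`, scalars absorbed into column `0`, `1 ≤ n`), back to polynomials
(`gmf_eq_of_repr`), and the count `qp_mul_absorb`. [folklore] -/
theorem smallTdr_of_quasiLocal (hB : LocalGeneratorsSmallTdr)
    (χ : (n : ℕ) → Equiv.Perm (Fin n) → ℂ) (hq : IsQuasiLocal χ) :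
    ∃ c : ℕ, ∀ n : ℕ, 1 ≤ n → ∃ r ≤ 2 ^ ((Nat.log 2 n + c) ^ c),
      ∃ E : Fin r → Matrix (Fin n) (Fin n) ℂ,
        (∑ σ : Equiv.Perm (Fin n), MvPolynomial.C (χ n σ) *
            ∏ i : Fin n, (MvPolynomial.X (σ i, i) : MvPolynomial (Fin n × Fin n) ℂ)) =
          ∑ t, (Matrix.of fun i j => MvPolynomial.C (E t i j) * MvPolynomial.X (i, j)).det := by
  obtain ⟨c₁, hq⟩ := hq
  obtain ⟨c, hc⟩ := qp_mul_absorb c₁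
  refine ⟨c, fun n hn => ?_⟩
  obtain ⟨r, hr, a, g, hg, hχ⟩ := hq n hn
  have hcone : ∀ t : Fin r,
      ∃ E : Fin ((n + 1) ^ ((Nat.log 2 n + c₁) ^ c₁ + 1)) → Matrix (Fin n) (Fin n) ℂ,
        ∀ σ : Equiv.Perm (Fin n),
          g t σ = ∑ s, ((Equiv.Perm.sign σ : ℤ) : ℂ) * ∏ i, E s (σ i) i := by
    intro t
    obtain ⟨E, hE⟩ := hB n ((Nat.log 2 n + c₁) ^ c₁) (g t) hn (hg t)
    exact ⟨E, fun σ => repr_of_gmf_eq (g t) E hE σ⟩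
  choose E hE using hcone
  obtain ⟨E', hE'⟩ := cone_lincomb hn a g E hE
  refine ⟨r * (n + 1) ^ ((Nat.log 2 n + c₁) ^ c₁ + 1),
    le_trans (Nat.mul_le_mul_right _ hr) (hc n), E', ?_⟩
  refine gmf_eq_of_repr (χ n) E' fun σ => ?_
  rw [← hE' σ, hχ]
  simp only [Finset.sum_apply, Pi.smul_apply, smul_eq_mul]

/-! ## §3 The composition (kernel-checked): R and SymA give the crux (B is landed) -/

/-- **Composition.** A p-computable class-function GMF family has quasi-polynomial-size
`S_n`-symmetric circuits (R); symmetric circuits of that size force quasi-local coefficients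
(SymA); quasi-local coefficients with the LANDED construction B
(`Theorems.TwistedDetRankFermionicNormalForm.stub_localGeneratorsSmallTdr`) give the fermionic
normal form (`smallTdr_of_quasiLocal`). [folklore] -/
theorem FermionicNormalForm_of :
    Registered.stub_restorationClassGMF → Registered.stub_symmetricCircuitsQuasiLocal →
      FermionicNormalForm := by
  intro hR hS χ hcl hP
  exact smallTdr_of_quasiLocal
    Summit.ValiantsHypothesis.ValiantsHypothesis.Theorems.TwistedDetRankFermionicNormalForm.stub_localGeneratorsSmallTdr
    χ (hS χ (hR χ hcl hP))

/-- Wiring check: the declared stubs feed `FermionicNormalForm_of` exactly as stated (sorries enter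
only through the two `stub_*`). -/
example : FermionicNormalForm :=
  FermionicNormalForm_of stub_restorationClassGMF stub_symmetricCircuitsQuasiLocal

/-! ## §4 Sharing and calibration (sorry-free)

R is literally the class-function-GMF case of `ProofCarryingSymmetry.RestorationQP`
(stmt-ValiantsHypothesis-10343): a class-function GMF is invariant under the diagonal relabelling
`x_ij ↦ x_{π i, π j}` (`rename_smul_gmf`) and is a p-family (`isPFamily_gmf`).  R alone implies the
summit (`valiantsHypothesis_of_restorationClassGMF`, through the PROVED Dawar–Wilsenach Thm 7.1);
SymA's `χ ≡ 1` instance is that theorem (`no_qp_symmetric_circuits_for_per_of_symA`). -/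

/-- A class-function GMF is invariant under the diagonal relabelling of the variable matrix:
reindex the permutation sum by conjugation `σ ↦ π σ π⁻¹` (`Equiv.permCongr`) and the product by
`π`, and use `χ (π σ π⁻¹) = χ σ`. [folklore] -/
theorem rename_smul_gmf {n : ℕ} (χ : Equiv.Perm (Fin n) → ℂ)
    (hcl : ∀ σ τ : Equiv.Perm (Fin n), χ (τ * σ * τ⁻¹) = χ σ) (π : Equiv.Perm (Fin n)) :
    MvPolynomial.rename (fun x : Fin n × Fin n => π • x)
        (∑ σ : Equiv.Perm (Fin n), MvPolynomial.C (χ σ) *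
          ∏ i : Fin n, (MvPolynomial.X (σ i, i) : MvPolynomial (Fin n × Fin n) ℂ)) =
      ∑ σ : Equiv.Perm (Fin n), MvPolynomial.C (χ σ) *
        ∏ i : Fin n, (MvPolynomial.X (σ i, i) : MvPolynomial (Fin n × Fin n) ℂ) := by
  simp only [map_sum, map_mul, map_prod, MvPolynomial.rename_C, MvPolynomial.rename_X]
  refine Fintype.sum_equiv (Equiv.permCongr π) _ _ fun σ => ?_
  have hχ : χ (Equiv.permCongr π σ) = χ σ := by
    rw [Equiv.permCongr_eq_mul]; exact hcl σ π
  rw [hχ]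
  congr 1
  refine Fintype.prod_equiv π _ _ fun i => ?_
  simp [Equiv.Perm.smul_def]

/-- A GMF family is a p-family: `n²` variables, total degree `≤ n`. [folklore] -/
theorem isPFamily_gmf (χ : (n : ℕ) → Equiv.Perm (Fin n) → ℂ) :
    IsPFamily (fun n => ∑ σ : Equiv.Perm (Fin n), MvPolynomial.C (χ n σ) *
      ∏ i : Fin n, (MvPolynomial.X (σ i, i) : MvPolynomial (Fin n × Fin n) ℂ)) := by
  constructor
  · refine ⟨2, fun n => ?_⟩
    simp only [Fintype.card_prod, Fintype.card_fin]
    nlinarith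
  · refine ⟨1, fun n => ?_⟩
    have hdeg : (∑ σ : Equiv.Perm (Fin n), MvPolynomial.C (χ n σ) *
        ∏ i : Fin n, (MvPolynomial.X (σ i, i) : MvPolynomial (Fin n × Fin n) ℂ)).totalDegree ≤ n := by
      refine (MvPolynomial.totalDegree_finsetSum _ _).trans (Finset.sup_le fun σ _ => ?_)
      refine (MvPolynomial.totalDegree_mul _ _).trans ?_
      rw [MvPolynomial.totalDegree_C, zero_add]
      refine (MvPolynomial.totalDegree_finsetProd _ _).trans ?_
      calc ∑ i : Fin n, (MvPolynomial.X (σ i, i) : MvPolynomial (Fin n × Fin n) ℂ).totalDegree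
          ≤ ∑ _i : Fin n, 1 := Finset.sum_le_sum fun i _ => by rw [MvPolynomial.totalDegree_X]
        _ = n := by simp
    dsimp only
    calc _ ≤ n := hdeg
      _ ≤ n ^ 1 + 1 := by simp

/-- **Sharing.** R is the class-function-GMF restriction of `ProofCarryingSymmetry.RestorationQP`
(stmt-ValiantsHypothesis-10343): closing that crux closes R. [folklore] -/
theorem restorationClassGMF_of_restorationQP :
    Summit.ValiantsHypothesis.ValiantsHypothesis.Theses.ProofCarryingSymmetry.RestorationQP →
      Registered.stub_restorationClassGMF := by
  intro hRQ χ hcl hP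
  exact hRQ (fun n => ∑ σ : Equiv.Perm (Fin n), MvPolynomial.C (χ n σ) *
      ∏ i : Fin n, (MvPolynomial.X (σ i, i) : MvPolynomial (Fin n × Fin n) ℂ))
    (fun n π => rename_smul_gmf (χ n) (hcl n) π) ⟨isPFamily_gmf χ, hP⟩

/-- `per_n` is the class-function GMF with `χ ≡ 1`. [folklore] -/
theorem gmf_one_eq_perPoly (n : ℕ) :
    (∑ σ : Equiv.Perm (Fin n), MvPolynomial.C (1 : ℂ) *
        ∏ i : Fin n, (MvPolynomial.X (σ i, i) : MvPolynomial (Fin n × Fin n) ℂ)) =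
      perPoly (Fin n) ℂ := by
  simp [perPoly, Matrix.permanent]

/-- **Calibration (honest).** Stub R alone implies the summit: under `VP ℂ = VNP ℂ` the permanent
family is p-computable (`isPComputable_perPoly_complex_iff`), it is the class-function GMF with
`χ ≡ 1`, so R gives `S_n`-symmetric circuits for `per_n` of size `≤ 2^((log₂ n + c)^c)` for every
`n`, against the PROVED Dawar–Wilsenach Theorem 7.1 (`squareSymmetricPermLB_proof`: size `≥ 2^{ε n}`
for arbitrarily large `n`) and `(log₂ n + c)^c < ε n` eventually
(`natLog_add_pow_lt_mul_eventually`).  So R is at least summit-hard — as every load-bearing stub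
of every line for this crux must be, since the crux implies the summit
(`valiantsHypothesis_of_fermionicNormalForm`). [DawarWilsenach2025 Thm 7.1] -/
theorem valiantsHypothesis_of_restorationClassGMF :
    Registered.stub_restorationClassGMF → _root_.ValiantsHypothesis := by
  intro hR
  show Literature.Computability.AlgebraicComplexity.VP ℂ ≠
    Literature.Computability.AlgebraicComplexity.VNP ℂ
  intro hEq
  have hper : IsPComputable (fun n => perPoly (Fin n) ℂ) :=
    isPComputable_perPoly_complex_iff.2 hEq
  have hfun : (fun n => ∑ σ : Equiv.Perm (Fin n), MvPolynomial.C (1 : ℂ) *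
        ∏ i : Fin n, (MvPolynomial.X (σ i, i) : MvPolynomial (Fin n × Fin n) ℂ)) =
      (fun n => perPoly (Fin n) ℂ) := funext gmf_one_eq_perPoly
  have hcomp : IsPComputable (fun n => ∑ σ : Equiv.Perm (Fin n), MvPolynomial.C (1 : ℂ) *
        ∏ i : Fin n, (MvPolynomial.X (σ i, i) : MvPolynomial (Fin n × Fin n) ℂ)) := by
    rw [hfun]; exact hper
  obtain ⟨c, hc⟩ := hR (fun _ _ => (1 : ℂ)) (fun _ _ _ => rfl) hcomp
  choose G hG C hsym heval hcard using hc
  have heval' : ∀ n, (C n).eval ((C n).output ()) = perPoly (Fin n) ℂ := fun n =>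
    (heval n).trans (gmf_one_eq_perPoly n)
  have hLB : Summit.ValiantsHypothesis.ValiantsHypothesis.Theses.ProofCarryingSymmetry.SquareSymmetricPermLB :=
    Summit.ValiantsHypothesis.ValiantsHypothesis.Theorems.squareSymmetricPermLB_proof
  obtain ⟨ε, hε, hio⟩ := @hLB G hG C hsym heval'
  obtain ⟨n₀, hn₀⟩ :=
    Summit.ValiantsHypothesis.Theorems.ProofCarryingSymmetry.natLog_add_pow_lt_mul_eventually c hε
  obtain ⟨n, hn, hle⟩ := hio n₀
  have h1 : (Fintype.card (G n) : ℝ) ≤ (2 : ℝ) ^ (((Nat.log 2 n + c) ^ c : ℕ) : ℝ) := by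
    rw [Real.rpow_natCast]
    exact_mod_cast hcard n
  have h2 : ε * n ≤ (((Nat.log 2 n + c) ^ c : ℕ) : ℝ) :=
    (Real.rpow_le_rpow_left_iff one_lt_two).1 (hle.trans h1)
  exact absurd (hn₀ n hn) (not_lt.2 h2)

/-- **SymA generalises Dawar–Wilsenach.** The `χ ≡ 1` instance of SymA says: the permanent family
has no `S_n`-symmetric circuits of quasi-polynomial size (because `χ ≡ 1` is not quasi-local,
`one_not_isQuasiLocal`) — the quasi-polynomial form of the in-tree Theorem 7.1. [DawarWilsenach2025 Thm 7.1] -/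
theorem no_qp_symmetric_circuits_for_per_of_symA (hS : Registered.stub_symmetricCircuitsQuasiLocal) :
    ¬ ∃ c : ℕ, ∀ n : ℕ, ∃ (G : Type) (_ : Fintype G)
        (C : LabelledArithCircuit ℂ (Fin n × Fin n) Unit G),
        C.IsSymmetric (Equiv.Perm (Fin n)) ∧
        C.eval (C.output ()) = perPoly (Fin n) ℂ ∧
        Fintype.card G ≤ 2 ^ ((Nat.log 2 n + c) ^ c) := by
  rintro ⟨c, hc⟩
  refine one_not_isQuasiLocal (hS (fun _ _ => (1 : ℂ)) ⟨c, fun n => ?_⟩)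
  obtain ⟨G, hG, C, hsym, heval, hcard⟩ := hc n
  exact ⟨G, hG, C, hsym, heval.trans (gmf_one_eq_perPoly n).symm, hcard⟩

end Summit.ValiantsHypothesis.ValiantsHypothesis.Cruxes.FermionicNormalForm.Symmetric
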